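import Literature.AnabelianGeometry.AbsoluteAnabelian.AbsTopIII.KummerCuspLaws
import HarnessLib

/-!
# [AbsTopIII] Thm. 1.9 (a): the decomposition groups of NF-points ARE the images of cuspidal
# decomposition groups of NF-complement opens — `Thm19a_decomp` at every law-abiding model (proof-only)

Mochizuki, *Topics in Absolute Anabelian Geometry III*, §1, Thm. 1.9 (a) p. 37 ("`U ⊆ Y` is an open
subscheme obtained by removing an arbitrary finite collection of NF-points [...] by allowing `U` to vary,
we obtain a 'group-theoretic' construction of `Π_U` equipped with the collection of subgroups that arise
as decomposition groups of NF-points"; lit key `paper:url-5493eb38cbb7`), with [AbsTopII] Cor. 3.7 (c)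
as quoted there ("the decomposition groups of the closed points of `X` lying in the complement of `U_X`
may be obtained as the images via `Π_{U_X} ↠ Π` of the cuspidal decomposition groups").

Proof-only companion (abc-iut-L4-t1, interface owner) of `KummerCuspLaws.lean`.  abc-iut-w5-d213's
named statement `CurveModel.Thm19a_decomp` (`Thm19Steps.lean`, sub-DAG row Thm19.a.r4:
`nfPointDecompSet X = cuspidalImageSet X` for scheme-like Thm-1.9 inputs `X`) is PROVED for every
`M : CoherentKummerModel` from the per-curve laws — the model-closure law `exists_open_removing` ("removing
an ARBITRARY finite collection of NF-points": the open `X ∖ {x}` is a curve of the model), the cusp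
bookkeeping `decomp_cuspPt` / `decomp_cuspPt_none`, the triviality `decomp_inf_geom` of `D_y ∩ Δ_X` —
and abc-iut-L4-t1's named fact `Prop_1_4_i` BY NAME (cuspidal inertia groups are free procyclic, hence
nontrivial, so a cuspidal decomposition group is never conjugate to that of a point):

* `CoherentKummerModel.thm19a_decomp (h14i : M.Prop_1_4_i) : M.Thm19a_decomp`.

All declarations are theorems; no new facts.  HONEST FRAMING: the functorial clause `Thm19a` (Belyi
cuspidalization, [AbsTopII] Cor. 3.8 — FACT-policy above the pGC boundary) is NOT touched; nothing here
bears on [IUTchIII] Cor. 3.12.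
-/

noncomputable section

open CategoryTheory
open scoped Classical Pointwise

namespace Literature.AnabelianGeometry.AbsoluteAnabelian.AbsTopIII

universe u

namespace CoherentKummerModel

variable (M : CoherentKummerModel.{u})

/-- A free procyclic group is not the trivial subgroup (it has an open subgroup of index `2`).
[cite: MochizukiAbsTopIII2015, Prop 1.4 (i) p.31] -/
theorem ne_bot_of_isFreeProcyclic {G : Type u} [Group G] [TopologicalSpace G] {I : Subgroup G}
    (hI : FundamentalExtension.IsFreeProcyclic I) : I ≠ ⊥ := by
  intro hbot
  obtain ⟨H, -, hidx⟩ := hI.exists_isOpen_index 2 two_pos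
  haveI : Subsingleton I := by
    rw [hbot]
    infer_instance
  have htop : H = ⊤ := Subsingleton.elim _ _
  rw [htop, Subgroup.index_top] at hidx
  exact absurd hidx (by norm_num)

/-- For a scheme-like curve of the model, a decomposition group of a closed point is never
`Π_X`-conjugate to a cuspidal decomposition group: the former meets `Δ_X` trivially (law
`decomp_inf_geom`), the latter in the inertia group `I_c ≅ Ẑ(1) ≠ 1` (Prop. 1.4 (i), `Prop_1_4_i` BY
NAME). [cite: MochizukiAbsTopIII2015, Prop 1.4 (i) p.31] -/
theorem decomp_ne_conj_Dcusp (h14i : M.Prop_1_4_i) {X : M.Curve} (hXs : M.IsScheme X) (y : M.Point X)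
    (c : (M.cusps X).Cusp) (g : (M.ext X).arith) :
    M.decomp X y ≠ MulAut.conj g • (M.cusps X).Dcusp c := by
  intro heq
  have h1 : M.decomp X y ⊓ (M.ext X).geom = ⊥ := M.decomp_inf_geom X hXs y
  rw [heq, ← Subgroup.Normal.conj_smul_eq_self g (M.ext X).geom, ← Subgroup.smul_inf,
    ← (M.cusps X).Icusp_eq] at h1
  have h2 : (M.cusps X).Icusp c = ⊥ := by
    have := congrArg (fun S : Subgroup (M.ext X).arith => (MulAut.conj g)⁻¹ • S) h1
    simpa only [inv_smul_smul, Subgroup.smul_bot] using this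
  exact ne_bot_of_isFreeProcyclic (h14i X hXs c) h2

/-- The cofinite open `X ∖ {x}` of the model removing ONE closed point `x` (law `exists_open_removing`),
with the cusp filling `x`. [cite: MochizukiAbsTopIII2015, Thm 1.9 (a) p.37] -/
theorem exists_open_removing_point {X : M.Curve} (hXs : M.IsScheme X) (x : M.Point X) :
    ∃ (U : M.Curve) (h : M.IsCofiniteOpen U X) (c : (M.cusps U).Cusp), M.cuspPt h c = some x ∧
      ∀ (c' : (M.cusps U).Cusp) (y : M.Point X), M.cuspPt h c' = some y → y = x := by
  obtain ⟨U, h, hU⟩ := M.exists_open_removing X {x} hXs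
  obtain ⟨c, hc⟩ := (hU x).2 (Finset.mem_singleton_self x)
  refine ⟨U, h, c, hc, fun c' y hy => ?_⟩
  exact Finset.mem_singleton.1 ((hU y).1 ⟨c', hy⟩)

/-- The open `X ∖ {x}` removes NF-points only, when `x` is an NF-point (`RemovesNFPoints`: every cusp of
`U = X ∖ {x}` is a cusp of `X` or fills `x`). [cite: MochizukiAbsTopIII2015, Thm 1.9 (a) p.37] -/
theorem removesNFPoints_of_removing_nfPoint {U X : M.Curve} (h : M.IsCofiniteOpen U X) (x : M.Point X)
    (hx : M.IsNFPoint X x) (hU : ∀ (c' : (M.cusps U).Cusp) (y : M.Point X), M.cuspPt h c' = some y → y = x) :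
    M.RemovesNFPoints h := by
  intro c'
  rcases hc' : M.cuspPt h c' with _ | y
  · obtain ⟨c'', g, hg⟩ := M.decomp_cuspPt_none h c' hc'
    exact Or.inl ⟨c'', g, hg⟩
  · have hy : y = x := hU c' y hc'
    subst hy
    obtain ⟨g, hg⟩ := M.decomp_cuspPt h c' y hc'
    exact Or.inr ⟨y, g, hx, hg⟩

/-- **Thm. 1.9 (a), decomposition groups of NF-points, at every law-abiding model**: for a scheme-like
Thm-1.9 input `X`, the `Π_X`-conjugates of decomposition groups of NF-points are EXACTLY the conjugates of
images of cuspidal decomposition groups of the NF-complement opens of the model that are not conjugate to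
a cuspidal decomposition group of `X` — abc-iut-w5-d213's named statement `Thm19a_decomp`, PROVED from
the per-curve laws and `Prop_1_4_i` BY NAME. [cite: MochizukiAbsTopIII2015, Thm 1.9 (a) p.37] -/
theorem thm19a_decomp (h14i : M.Prop_1_4_i) : M.Thm19a_decomp := by
  intro X _ hXs
  ext D
  constructor
  · rintro ⟨x, g, hx, rfl⟩
    obtain ⟨U, h, c, hc, hU⟩ := M.exists_open_removing_point hXs x
    obtain ⟨g', hg'⟩ := M.decomp_cuspPt h c x hc
    refine ⟨⟨U, h, c, g * g'⁻¹, M.removesNFPoints_of_removing_nfPoint h x hx hU, ?_⟩, ?_⟩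
    · change MulAut.conj g • M.decomp X x =
        MulAut.conj (g * g'⁻¹) • ((M.cusps U).Dcusp c).map (M.res h).arith.toMonoidHom
      rw [hg', map_mul, map_inv, mul_smul, inv_smul_smul]
    · rintro ⟨c', g₂, heq⟩
      apply M.decomp_ne_conj_Dcusp h14i hXs x c' (g⁻¹ * g₂)
      rw [map_mul, map_inv, mul_smul, ← heq, inv_smul_smul]
  · rintro ⟨⟨U, h, c, g, hrem, rfl⟩, hnot⟩
    rcases hrem c with ⟨c', g', hc'⟩ | ⟨y, g', hy, hcy⟩
    · exact absurd ⟨c', g * g', by rw [hc', map_mul, mul_smul]⟩ hnot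
    · exact ⟨y, g * g', hy, by rw [hcy, map_mul, mul_smul]⟩

end CoherentKummerModel

end Literature.AnabelianGeometry.AbsoluteAnabelian.AbsTopIII
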